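import Summits.ValiantsHypothesis.ValiantsHypothesis.Theorems.KPlusLogSqLawTridiagonalRealStaticUnitSmall

/-!
# Route «KPlusLogSqLaw», crux `WeakLifting` (stmt-ValiantsHypothesis-19561) — REAL side of the tridiagonal sector:
# the UNIT-COEFFICIENT sub-sector at size `5` — the OUTER-SLOPE LAW: a third positive zero needs OPPOSITE outer slopes

HONEST FRAMING.  Helper theorems (`--supports stmt-ValiantsHypothesis-19561 --as helper`), seat val-sym-lift-p1 (g15), cell `pub-symmetroid`,
2026-08-28; third file of the unit sub-sector series (`…UnitSmall`: resonance law, `U 3 = 1`, `U 4 = 2`; `…UnitRows`: `U 6 ≥ 3`, `U 7 ≥ 4`;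
`…UnitShadow`, p601719: `U 5 ≥ 3`).  Currency `StaticTridiagonalRealPotential.pathDet (fun _ => 1) d (fun _ => 1) f 5`; edge slopes
`L_t := 2f_t − d_t − d_{t+1} ∈ ℤ` (`t = 0,…,3`); normalised determinant
`Q = 1 − b₀ − b₁ − b₂ − b₃ + b₀b₂ + b₀b₃ + b₁b₃ = (1 − b₀)(1 − b₃) − b₁(1 − b₃) − b₂(1 − b₀)`, `b_t = x^{L_t}` (the eight matchings of the path `P₅`).
By the resonance law `x = 1` is ALWAYS a zero at size `5`.  Proved here, for all exponent data:
* **OUTER-SLOPE LAW** (`card_posRoots_unit_five_le_two_of_outer`): if the two OUTER slopes do not have strictly opposite signs (`L₀ · L₃ ≥ 0`) the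
  design has at most TWO distinct positive zeros: an outer slope `0` leaves only `x = 1` (`Q = −b₁(1 − b₃)`); outer slopes of one sign make `Q > 0`
  on the side where `b₀, b₃ > 1` (`Q = (b₀−1)(b₃−1) + b₁(b₃−1) + b₂(b₀−1)`) and leave at most one zero on the other side (the secular form
  `b₁/(1−b₀) + b₂/(1−b₃) = 1` is `> 1` unless all four slopes share the sign, and strictly monotone then) — `unit_five_aux_gt_one`.
So the third zero of the located row `U 5 = 3` (p601719's design has `L = (4, −1, −1, −1)`) REQUIRES `L₀ L₃ < 0`; in that regime each side of `x = 1` can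
carry two zeros (located: `L = (20, 1, 5, −19)` has two in `(0,1)`), and the located law «at most two zeros off `x = 1`» (exact Sturm census of every
slope vector in `[−4,4]⁴` plus 2 250 lopsided probes, seat memo UNIT-SUBSECTOR-liftp1g15.md) is NOT proved here.  Nothing here is an upper law for
the register (α NO MOVER); nothing bears on `WeakLifting` / `TropicalB` (stmt-19771) in their windows, Conjecture B, the Door-A registers,
`MatrixDescartes` (stmt-18050) or VP ≠ VNP.
[this seat; folklore: continuants ↔ matchings of the path, secular equation of a diagonal-plus-rank-one matrix]
-/

-- `Summit.ValiantsHypothesis.ValiantsHypothesis.…` repeats a component by the D-0017 layout (single-conjunct summit); the name is mandated.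
set_option linter.dupNamespace false
set_option autoImplicit false

namespace Summit.ValiantsHypothesis.ValiantsHypothesis.Theorems.KPlusLogSqLaw
namespace StaticTridiagonalRealUnit

open Polynomial Finset
open Summit.ValiantsHypothesis.ValiantsHypothesis.Theorems.KPlusLogSqLaw.StaticTridiagonalRealPotential
  (pathDet pathDet_zero pathDet_one pathDet_add_two)

variable (d : ℕ → ℕ) (f : ℕ → ℕ)

/-! ### The unit `5 × 5` determinant and its normalised form -/

/-- the unit `5 × 5` determinant: the eight matchings of the path on five vertices. [folklore] -/
theorem eval_unit_five (x : ℝ) :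
    (pathDet (fun _ => (1 : ℝ)) d (fun _ => (1 : ℝ)) f 5).eval x =
      x ^ (d 4 + (d 3 + (d 2 + (d 1 + d 0)))) - x ^ (d 4 + (d 3 + (d 2 + 2 * f 0))) - x ^ (d 4 + (d 3 + (2 * f 1 + d 0))) -
        x ^ (d 4 + (2 * f 2 + (d 1 + d 0))) + x ^ (d 4 + (2 * f 2 + 2 * f 0)) - x ^ (2 * f 3 + (d 2 + (d 1 + d 0))) +
        x ^ (2 * f 3 + (d 2 + 2 * f 0)) + x ^ (2 * f 3 + (2 * f 1 + d 0)) := by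
  have e4 := eval_unit_four d f x
  have e3 := eval_unit_three d f x
  rw [show (5 : ℕ) = 3 + 2 from rfl, pathDet_add_two]
  simp only [eval_sub, eval_mul, eval_pow, eval_C, eval_X, one_mul]
  rw [show (3 : ℕ) + 1 = 4 from rfl, e4, e3]
  ring

/-- normalised form at `x ≠ 0`: `D₅(x) = x^{E} · ((1 − b₀)(1 − b₃) − b₁(1 − b₃) − b₂(1 − b₀))`, `b_t = x^{L_t}`, `L_t = 2f_t − d_t − d_{t+1}`. -/
theorem eval_unit_five_eq (x : ℝ) (hx : x ≠ 0) :
    (pathDet (fun _ => (1 : ℝ)) d (fun _ => (1 : ℝ)) f 5).eval x =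
      x ^ (d 4 + (d 3 + (d 2 + (d 1 + d 0)))) *
        ((1 - x ^ ((2 * f 0 : ℤ) - d 0 - d 1)) * (1 - x ^ ((2 * f 3 : ℤ) - d 3 - d 4)) -
          x ^ ((2 * f 1 : ℤ) - d 1 - d 2) * (1 - x ^ ((2 * f 3 : ℤ) - d 3 - d 4)) -
          x ^ ((2 * f 2 : ℤ) - d 2 - d 3) * (1 - x ^ ((2 * f 0 : ℤ) - d 0 - d 1))) := by
  have e0 := pow_eq_pow_mul_zpow hx (p := d 4 + (d 3 + (d 2 + 2 * f 0))) (E := d 4 + (d 3 + (d 2 + (d 1 + d 0))))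
    (L := (2 * f 0 : ℤ) - d 0 - d 1) (by push_cast; ring)
  have e1 := pow_eq_pow_mul_zpow hx (p := d 4 + (d 3 + (2 * f 1 + d 0))) (E := d 4 + (d 3 + (d 2 + (d 1 + d 0))))
    (L := (2 * f 1 : ℤ) - d 1 - d 2) (by push_cast; ring)
  have e2 := pow_eq_pow_mul_zpow hx (p := d 4 + (2 * f 2 + (d 1 + d 0))) (E := d 4 + (d 3 + (d 2 + (d 1 + d 0))))
    (L := (2 * f 2 : ℤ) - d 2 - d 3) (by push_cast; ring)
  have e3 := pow_eq_pow_mul_zpow hx (p := 2 * f 3 + (d 2 + (d 1 + d 0))) (E := d 4 + (d 3 + (d 2 + (d 1 + d 0))))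
    (L := (2 * f 3 : ℤ) - d 3 - d 4) (by push_cast; ring)
  have e02 := pow_eq_pow_mul_zpow hx (p := d 4 + (2 * f 2 + 2 * f 0)) (E := d 4 + (d 3 + (d 2 + (d 1 + d 0))))
    (L := ((2 * f 0 : ℤ) - d 0 - d 1) + ((2 * f 2 : ℤ) - d 2 - d 3)) (by push_cast; ring)
  have e03 := pow_eq_pow_mul_zpow hx (p := 2 * f 3 + (d 2 + 2 * f 0)) (E := d 4 + (d 3 + (d 2 + (d 1 + d 0))))
    (L := ((2 * f 0 : ℤ) - d 0 - d 1) + ((2 * f 3 : ℤ) - d 3 - d 4)) (by push_cast; ring)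
  have e13 := pow_eq_pow_mul_zpow hx (p := 2 * f 3 + (2 * f 1 + d 0)) (E := d 4 + (d 3 + (d 2 + (d 1 + d 0))))
    (L := ((2 * f 1 : ℤ) - d 1 - d 2) + ((2 * f 3 : ℤ) - d 3 - d 4)) (by push_cast; ring)
  rw [eval_unit_five, e0, e1, e2, e3, e02, e03, e13, zpow_add₀ hx, zpow_add₀ hx, zpow_add₀ hx]
  ring

/-- at a positive zero, `(1 − b₀)(1 − b₃) = b₁(1 − b₃) + b₂(1 − b₀)`. -/
theorem unit_five_root_eq {x : ℝ} (hx : 0 < x)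
    (h : (pathDet (fun _ => (1 : ℝ)) d (fun _ => (1 : ℝ)) f 5).eval x = 0) :
    (1 - x ^ ((2 * f 0 : ℤ) - d 0 - d 1)) * (1 - x ^ ((2 * f 3 : ℤ) - d 3 - d 4)) =
      x ^ ((2 * f 1 : ℤ) - d 1 - d 2) * (1 - x ^ ((2 * f 3 : ℤ) - d 3 - d 4)) +
        x ^ ((2 * f 2 : ℤ) - d 2 - d 3) * (1 - x ^ ((2 * f 0 : ℤ) - d 0 - d 1)) := by
  rw [eval_unit_five_eq d f x hx.ne'] at h
  rcases mul_eq_zero.1 h with h | h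
  · exact absurd h (pow_ne_zero _ hx.ne')
  · linarith

/-! ### The mechanism -/

/-- **dead side**: if both outer powers exceed `1` the normalised determinant is positive:
`(1 − b₀)(1 − b₃) − b₁(1 − b₃) − b₂(1 − b₀) = (b₀ − 1)(b₃ − 1) + b₁(b₃ − 1) + b₂(b₀ − 1) > 0`. -/
theorem unit_five_pos {b₀ b₁ b₂ b₃ : ℝ} (h0 : 1 < b₀) (h3 : 1 < b₃) (h1 : 0 < b₁) (h2 : 0 < b₂) :
    (1 - b₀) * (1 - b₃) ≠ b₁ * (1 - b₃) + b₂ * (1 - b₀) := by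
  intro h
  nlinarith [mul_pos (sub_pos.2 h0) (sub_pos.2 h3), mul_pos h1 (sub_pos.2 h3), mul_pos h2 (sub_pos.2 h0)]

/-- **live side**: with both outer slopes negative, the root equation has at most one solution `x > 1` (an inner slope `≥ 0` makes
`b₁/(1 − b₀) + b₂/(1 − b₃) > 1`; four negative slopes make it strictly decreasing). [this file] -/
theorem unit_five_aux_gt_one (L₀ L₁ L₂ L₃ : ℤ) (hL0 : L₀ < 0) (hL3 : L₃ < 0) {x y : ℝ} (hx : 1 < x) (hxy : x < y)
    (hxr : (1 - x ^ L₀) * (1 - x ^ L₃) = x ^ L₁ * (1 - x ^ L₃) + x ^ L₂ * (1 - x ^ L₀))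
    (hyr : (1 - y ^ L₀) * (1 - y ^ L₃) = y ^ L₁ * (1 - y ^ L₃) + y ^ L₂ * (1 - y ^ L₀)) : False := by
  have hx0 : 0 < x := one_pos.trans hx
  have hy : 1 < y := hx.trans hxy
  have hy0 : 0 < y := hx0.trans hxy
  have p0 : 0 < 1 - x ^ L₀ := sub_pos.2 (zpow_lt_one_of_neg₀ hx hL0)
  have p3 : 0 < 1 - x ^ L₃ := sub_pos.2 (zpow_lt_one_of_neg₀ hx hL3)
  -- an inner slope `≥ 0` kills every root on `(1, ∞)`
  rcases le_or_gt 0 L₁ with hL1 | hL1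
  · have h1 : 1 - x ^ L₀ < x ^ L₁ := by linarith [one_le_zpow₀ hx.le hL1, zpow_pos hx0 L₀]
    nlinarith [mul_pos (zpow_pos hx0 L₂) p0, mul_lt_mul_of_pos_right h1 p3]
  rcases le_or_gt 0 L₂ with hL2 | hL2
  · have h2 : 1 - x ^ L₃ < x ^ L₂ := by linarith [one_le_zpow₀ hx.le hL2, zpow_pos hx0 L₃]
    nlinarith [mul_pos (zpow_pos hx0 L₁) p3, mul_lt_mul_of_pos_right h2 p0]
  -- four negative slopes: the secular form `b₁/(1−b₀) + b₂/(1−b₃)` is strictly decreasing on `(1, ∞)`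
  have q0 : 0 < 1 - y ^ L₀ := sub_pos.2 (zpow_lt_one_of_neg₀ hy hL0)
  have q3 : 0 < 1 - y ^ L₃ := sub_pos.2 (zpow_lt_one_of_neg₀ hy hL3)
  have ex : ∀ z : ℝ, 0 < 1 - z ^ L₀ → 0 < 1 - z ^ L₃ →
      (1 - z ^ L₀) * (1 - z ^ L₃) = z ^ L₁ * (1 - z ^ L₃) + z ^ L₂ * (1 - z ^ L₀) →
      z ^ L₁ / (1 - z ^ L₀) + z ^ L₂ / (1 - z ^ L₃) = 1 := by
    intro z hz0 hz3 h
    rw [div_add_div _ _ hz0.ne' hz3.ne', div_eq_one_iff_eq (mul_pos hz0 hz3).ne']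
    linarith
  have fx := ex x p0 p3 hxr
  have fy := ex y q0 q3 hyr
  have a1 : y ^ L₁ / (1 - y ^ L₀) < x ^ L₁ / (1 - x ^ L₀) :=
    calc y ^ L₁ / (1 - y ^ L₀) < x ^ L₁ / (1 - y ^ L₀) :=
          div_lt_div_of_pos_right (zpow_lt_zpow_left_of_neg hL1 hx0 hxy) q0
      _ ≤ x ^ L₁ / (1 - x ^ L₀) :=
          div_le_div_of_nonneg_left (zpow_pos hx0 _).le p0 (by linarith [zpow_lt_zpow_left_of_neg hL0 hx0 hxy])
  have a2 : y ^ L₂ / (1 - y ^ L₃) < x ^ L₂ / (1 - x ^ L₃) :=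
    calc y ^ L₂ / (1 - y ^ L₃) < x ^ L₂ / (1 - y ^ L₃) :=
          div_lt_div_of_pos_right (zpow_lt_zpow_left_of_neg hL2 hx0 hxy) q3
      _ ≤ x ^ L₂ / (1 - x ^ L₃) :=
          div_le_div_of_nonneg_left (zpow_pos hx0 _).le p3 (by linarith [zpow_lt_zpow_left_of_neg hL3 hx0 hxy])
  linarith

/-- the same on `(0, 1)` for positive outer slopes, transported by `x ↦ x⁻¹`. [this file] -/
theorem unit_five_aux_lt_one (L₀ L₁ L₂ L₃ : ℤ) (hL0 : 0 < L₀) (hL3 : 0 < L₃) {x y : ℝ} (hx : 0 < x) (hxy : x < y) (hy : y < 1)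
    (hxr : (1 - x ^ L₀) * (1 - x ^ L₃) = x ^ L₁ * (1 - x ^ L₃) + x ^ L₂ * (1 - x ^ L₀))
    (hyr : (1 - y ^ L₀) * (1 - y ^ L₃) = y ^ L₁ * (1 - y ^ L₃) + y ^ L₂ * (1 - y ^ L₀)) : False := by
  have hy0 : 0 < y := hx.trans hxy
  have key : ∀ z : ℝ, ∀ L : ℤ, z⁻¹ ^ (-L) = z ^ L := fun z L => by rw [inv_zpow', neg_neg]
  refine unit_five_aux_gt_one (-L₀) (-L₁) (-L₂) (-L₃) (by omega) (by omega) (x := y⁻¹) (y := x⁻¹)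
    ((one_lt_inv₀ hy0).2 hy) ((inv_lt_inv₀ hy0 hx).2 hxy) ?_ ?_
  · rw [key, key, key, key]; exact hyr
  · rw [key, key, key, key]; exact hxr

/-! ### The outer-slope law -/

/-- if BOTH outer slopes vanish the unit `5 × 5` determinant is identically zero (`Q = −b₁(1 − b₃) = 0`). -/
theorem unit_five_eq_zero_of_outer_zero (h0 : (2 * f 0 : ℤ) - d 0 - d 1 = 0) (h3 : (2 * f 3 : ℤ) - d 3 - d 4 = 0) :
    pathDet (fun _ => (1 : ℝ)) d (fun _ => (1 : ℝ)) f 5 = 0 := by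
  refine Polynomial.eq_zero_of_infinite_isRoot _ ((Set.Ioi_infinite (0 : ℝ)).mono fun z hz => ?_)
  have hz0 : (z : ℝ) ≠ 0 := ne_of_gt hz
  show (pathDet (fun _ => (1 : ℝ)) d (fun _ => (1 : ℝ)) f 5).IsRoot z
  rw [IsRoot, eval_unit_five_eq d f z hz0, h0, h3, zpow_zero, sub_self]
  ring

/-- with ONE outer slope zero, every positive zero of a (nonzero) unit `5 × 5` determinant is `x = 1`. -/
theorem unit_five_root_eq_one_of_outer_zero (h03 : (2 * f 0 : ℤ) - d 0 - d 1 = 0 ∨ (2 * f 3 : ℤ) - d 3 - d 4 = 0)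
    (hD : pathDet (fun _ => (1 : ℝ)) d (fun _ => (1 : ℝ)) f 5 ≠ 0) {x : ℝ} (hx : 0 < x)
    (hr : (pathDet (fun _ => (1 : ℝ)) d (fun _ => (1 : ℝ)) f 5).eval x = 0) : x = 1 := by
  have hxr := unit_five_root_eq d f hx hr
  by_contra hne
  rcases h03 with h0 | h3
  · rw [h0, zpow_zero, sub_self, zero_mul, mul_zero, add_zero] at hxr
    have h13 : x ^ ((2 * f 3 : ℤ) - d 3 - d 4) = 1 := by
      nlinarith [zpow_pos hx ((2 * f 1 : ℤ) - d 1 - d 2), zpow_pos hx ((2 * f 3 : ℤ) - d 3 - d 4)]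
    exact hD (unit_five_eq_zero_of_outer_zero d f h0 ((zpow_eq_one_iff_right₀ hx.le hne).1 h13))
  · rw [h3, zpow_zero, sub_self, mul_zero, mul_zero, zero_add] at hxr
    have h10 : x ^ ((2 * f 0 : ℤ) - d 0 - d 1) = 1 := by
      nlinarith [zpow_pos hx ((2 * f 2 : ℤ) - d 2 - d 3), zpow_pos hx ((2 * f 0 : ℤ) - d 0 - d 1)]
    exact hD (unit_five_eq_zero_of_outer_zero d f ((zpow_eq_one_iff_right₀ hx.le hne).1 h10) h3)

/-- **OUTER-SLOPE LAW at size `5` (kernel, all exponents)**: a unit-coefficient static symmetric tridiagonal `5 × 5` design whose outer edge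
slopes `L₀ = 2f₀ − d₀ − d₁` and `L₃ = 2f₃ − d₃ − d₄` do NOT have strictly opposite signs (`0 ≤ L₀ · L₃`) has at most TWO distinct positive
determinant zeros (one of them `x = 1`): an outer slope `0` leaves only `x = 1`; outer slopes of one sign leave no zero on the side where the
outer powers exceed `1` and at most one on the other side.  Hence the third zero of the located row `U 5 = 3` requires `L₀ L₃ < 0`. [this file] -/
theorem card_posRoots_unit_five_le_two_of_outer
    (h : 0 ≤ ((2 * f 0 : ℤ) - d 0 - d 1) * ((2 * f 3 : ℤ) - d 3 - d 4)) :
    ((pathDet (fun _ => (1 : ℝ)) d (fun _ => (1 : ℝ)) f 5).roots.toFinset.filter (fun x => 0 < x)).card ≤ 2 := by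
  set S := (pathDet (fun _ => (1 : ℝ)) d (fun _ => (1 : ℝ)) f 5).roots.toFinset.filter (fun x => 0 < x) with hS
  have mem : ∀ x, x ∈ S → pathDet (fun _ => (1 : ℝ)) d (fun _ => (1 : ℝ)) f 5 ≠ 0 ∧ 0 < x ∧
      (pathDet (fun _ => (1 : ℝ)) d (fun _ => (1 : ℝ)) f 5).eval x = 0 := by
    intro x hx
    simp only [hS, Finset.mem_filter, Multiset.mem_toFinset, mem_roots', IsRoot.def] at hx
    exact ⟨hx.1.1, hx.2, hx.1.2⟩
  by_cases hz : (2 * f 0 : ℤ) - d 0 - d 1 = 0 ∨ (2 * f 3 : ℤ) - d 3 - d 4 = 0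
  · -- (a) an outer slope vanishes: `S ⊆ {1}`
    refine (Finset.card_le_one.2 fun x hx y hy => ?_).trans one_le_two
    obtain ⟨hD, hx0, hxr⟩ := mem x hx
    obtain ⟨-, hy0, hyr⟩ := mem y hy
    rw [unit_five_root_eq_one_of_outer_zero d f hz hD hx0 hxr, unit_five_root_eq_one_of_outer_zero d f hz hD hy0 hyr]
  · obtain ⟨hz0, hz3⟩ := not_or.1 hz
    -- (b) outer slopes of one strict sign
    have hsign : ((2 * f 0 : ℤ) - d 0 - d 1 < 0 ∧ (2 * f 3 : ℤ) - d 3 - d 4 < 0) ∨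
        (0 < (2 * f 0 : ℤ) - d 0 - d 1 ∧ 0 < (2 * f 3 : ℤ) - d 3 - d 4) := by
      rcases lt_or_gt_of_ne hz0 with h0 | h0
      · rcases lt_or_gt_of_ne hz3 with h3 | h3
        · exact Or.inl ⟨h0, h3⟩
        · exact absurd h (not_le.2 (mul_neg_of_neg_of_pos h0 h3))
      · rcases lt_or_gt_of_ne hz3 with h3 | h3
        · exact absurd h (not_le.2 (mul_neg_of_pos_of_neg h0 h3))
        · exact Or.inr ⟨h0, h3⟩
    -- `S ⊆ {1} ∪ (live side)`, and the live side carries at most one zero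
    have key : ∀ (live : ℝ → Prop) [DecidablePred live],
        (∀ x, x ∈ S → x = 1 ∨ live x) → (∀ x, x ∈ S → ∀ y, y ∈ S → live x → live y → x = y) → S.card ≤ 2 := by
      intro live _ hcover huniq
      have hsub : S ⊆ insert 1 (S.filter live) := by
        intro x hx
        rcases hcover x hx with h1 | h1
        · rw [h1]; exact Finset.mem_insert_self _ _
        · exact Finset.mem_insert_of_mem (Finset.mem_filter.2 ⟨hx, h1⟩)
      have h1 : (S.filter live).card ≤ 1 := Finset.card_le_one.2 fun x hx y hy =>
        huniq x (Finset.mem_filter.1 hx).1 y (Finset.mem_filter.1 hy).1 (Finset.mem_filter.1 hx).2 (Finset.mem_filter.1 hy).2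
      exact (Finset.card_le_card hsub).trans ((Finset.card_insert_le _ _).trans (by omega))
    rcases hsign with ⟨h0, h3⟩ | ⟨h0, h3⟩
    · -- both outer slopes negative: dead side `(0, 1)`, live side `(1, ∞)`
      refine key (fun x => 1 < x) (fun x hx => ?_) (fun x hx y hy hxl hyl => ?_)
      · obtain ⟨-, hx0, hxr⟩ := mem x hx
        rcases lt_trichotomy x 1 with hlt | heq | hgt
        · exact absurd (unit_five_root_eq d f hx0 hxr) (unit_five_pos (one_lt_zpow_of_neg₀ hx0 hlt h0)
            (one_lt_zpow_of_neg₀ hx0 hlt h3) (zpow_pos hx0 _) (zpow_pos hx0 _))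
        · exact Or.inl heq
        · exact Or.inr hgt
      · obtain ⟨-, hx0, hxr⟩ := mem x hx
        obtain ⟨-, hy0, hyr⟩ := mem y hy
        by_contra hne
        rcases lt_or_gt_of_ne hne with hlt | hgt
        · exact unit_five_aux_gt_one _ _ _ _ h0 h3 hxl hlt (unit_five_root_eq d f hx0 hxr) (unit_five_root_eq d f hy0 hyr)
        · exact unit_five_aux_gt_one _ _ _ _ h0 h3 hyl hgt (unit_five_root_eq d f hy0 hyr) (unit_five_root_eq d f hx0 hxr)
    · -- both outer slopes positive: dead side `(1, ∞)`, live side `(0, 1)`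
      refine key (fun x => x < 1) (fun x hx => ?_) (fun x hx y hy hxl hyl => ?_)
      · obtain ⟨-, hx0, hxr⟩ := mem x hx
        rcases lt_trichotomy x 1 with hlt | heq | hgt
        · exact Or.inr hlt
        · exact Or.inl heq
        · exact absurd (unit_five_root_eq d f hx0 hxr) (unit_five_pos (one_lt_zpow₀ hgt h0) (one_lt_zpow₀ hgt h3)
            (zpow_pos hx0 _) (zpow_pos hx0 _))
      · obtain ⟨-, hx0, hxr⟩ := mem x hx
        obtain ⟨-, hy0, hyr⟩ := mem y hy
        by_contra hne
        rcases lt_or_gt_of_ne hne with hlt | hgt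
        · exact unit_five_aux_lt_one _ _ _ _ h0 h3 hx0 hlt hyl (unit_five_root_eq d f hx0 hxr) (unit_five_root_eq d f hy0 hyr)
        · exact unit_five_aux_lt_one _ _ _ _ h0 h3 hy0 hgt hxl (unit_five_root_eq d f hy0 hyr) (unit_five_root_eq d f hx0 hxr)

/-! ### Appendix (same seat, same day): the ANTI-RESONANT hyperplane `L₀ + L₃ = 0`

When the outer slopes are exactly opposite (`L₀ = −L₃ = ±a`; then `x = 1` is a multiple zero) the determinant factors as `(X^a − 1)` times a
FOUR-monomial polynomial that also vanishes at `1`; Descartes (support count) bounds the cofactor's positive zeros, with multiplicity, by `3`,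
so the design has at most THREE distinct positive zeros there.  Together with the outer-slope law: `Z ≤ 2` if `L₀L₃ ≥ 0`, `Z ≤ 3` if `L₀ + L₃ = 0`;
the located law `Z ≤ 3` remains open exactly for `L₀L₃ < 0`, `L₀ + L₃ ≠ 0`. -/

/-- factorisation for `L₀ = a`, `L₃ = −a`: `D₅ = (X^a − 1)·(X^{E+L₂} − X^{E+L₁−a} − X^{E} + X^{E−a})`, `E = Σ d_t`. [this file] -/
theorem unit_five_eq_mul_of_antiResonant (a : ℕ) (h0 : 2 * f 0 = a + d 0 + d 1) (h3 : 2 * f 3 + a = d 3 + d 4) :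
    pathDet (fun _ => (1 : ℝ)) d (fun _ => (1 : ℝ)) f 5 =
      (X ^ a - 1) * (X ^ (d 4 + d 0 + d 1 + 2 * f 2) - X ^ (d 0 + 2 * f 1 + 2 * f 3) -
        X ^ (d 4 + (d 3 + (d 2 + (d 1 + d 0)))) + X ^ (d 2 + d 1 + d 0 + 2 * f 3)) := by
  refine Polynomial.funext fun x => ?_
  rw [eval_unit_five]
  simp only [eval_mul, eval_sub, eval_add, eval_pow, eval_X, eval_one]
  have e1 : x ^ (d 4 + (d 3 + (d 2 + 2 * f 0))) = x ^ a * x ^ (d 4 + (d 3 + (d 2 + (d 1 + d 0)))) := by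
    rw [← pow_add]; congr 1; omega
  have e2 : x ^ (d 4 + (d 3 + (2 * f 1 + d 0))) = x ^ a * x ^ (d 0 + 2 * f 1 + 2 * f 3) := by
    rw [← pow_add]; congr 1; omega
  have e3 : x ^ (d 4 + (2 * f 2 + 2 * f 0)) = x ^ a * x ^ (d 4 + d 0 + d 1 + 2 * f 2) := by
    rw [← pow_add]; congr 1; omega
  have e4 : x ^ (2 * f 3 + (d 2 + 2 * f 0)) = x ^ a * x ^ (d 2 + d 1 + d 0 + 2 * f 3) := by
    rw [← pow_add]; congr 1; omega
  have e5 : x ^ (2 * f 3 + (2 * f 1 + d 0)) = x ^ (d 0 + 2 * f 1 + 2 * f 3) := by congr 1; omega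
  have e6 : x ^ (2 * f 3 + (d 2 + (d 1 + d 0))) = x ^ (d 2 + d 1 + d 0 + 2 * f 3) := by congr 1; omega
  have e7 : x ^ (d 4 + (2 * f 2 + (d 1 + d 0))) = x ^ (d 4 + d 0 + d 1 + 2 * f 2) := by congr 1; omega
  rw [e1, e2, e3, e4, e5, e6, e7]
  ring

/-- factorisation for `L₃ = a`, `L₀ = −a` (the mirror case): `D₅ = (X^a − 1)·(X^{E+L₁} − X^{E+L₂−a} − X^{E} + X^{E−a})`. [this file] -/
theorem unit_five_eq_mul_of_antiResonant' (a : ℕ) (h3 : 2 * f 3 = a + d 3 + d 4) (h0 : 2 * f 0 + a = d 0 + d 1) :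
    pathDet (fun _ => (1 : ℝ)) d (fun _ => (1 : ℝ)) f 5 =
      (X ^ a - 1) * (X ^ (d 0 + d 3 + d 4 + 2 * f 1) - X ^ (d 4 + 2 * f 2 + 2 * f 0) -
        X ^ (d 4 + (d 3 + (d 2 + (d 1 + d 0)))) + X ^ (d 2 + d 3 + d 4 + 2 * f 0)) := by
  refine Polynomial.funext fun x => ?_
  rw [eval_unit_five]
  simp only [eval_mul, eval_sub, eval_add, eval_pow, eval_X, eval_one]
  have e1 : x ^ (2 * f 3 + (d 2 + (d 1 + d 0))) = x ^ a * x ^ (d 4 + (d 3 + (d 2 + (d 1 + d 0)))) := by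
    rw [← pow_add]; congr 1; omega
  have e2 : x ^ (2 * f 3 + (2 * f 1 + d 0)) = x ^ a * x ^ (d 0 + d 3 + d 4 + 2 * f 1) := by
    rw [← pow_add]; congr 1; omega
  have e3 : x ^ (d 4 + (2 * f 2 + (d 1 + d 0))) = x ^ a * x ^ (d 4 + 2 * f 2 + 2 * f 0) := by
    rw [← pow_add]; congr 1; omega
  have e4 : x ^ (2 * f 3 + (d 2 + 2 * f 0)) = x ^ a * x ^ (d 2 + d 3 + d 4 + 2 * f 0) := by
    rw [← pow_add]; congr 1; omega
  have e5 : x ^ (d 4 + (d 3 + (2 * f 1 + d 0))) = x ^ (d 0 + d 3 + d 4 + 2 * f 1) := by congr 1; omega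
  have e6 : x ^ (d 4 + (d 3 + (d 2 + 2 * f 0))) = x ^ (d 2 + d 3 + d 4 + 2 * f 0) := by congr 1; omega
  rw [e1, e2, e3, e4, e5, e6]
  ring

/-- a four-monomial polynomial has at most four support points. -/
theorem card_support_fourNomial_le (p₁ p₂ p₃ p₄ : ℕ) :
    ((X : ℝ[X]) ^ p₁ - X ^ p₂ - X ^ p₃ + X ^ p₄).support.card ≤ 4 := by
  have ha : ∀ p q : ℝ[X], (p + q).support.card ≤ p.support.card + q.support.card := fun p q =>
    (Finset.card_le_card Polynomial.support_add).trans (Finset.card_union_le _ _)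
  have hs : ∀ p q : ℝ[X], (p - q).support.card ≤ p.support.card + q.support.card := fun p q => by
    have h := ha p (-q)
    rwa [Polynomial.support_neg, ← sub_eq_add_neg] at h
  have c : ∀ n : ℕ, ((X : ℝ[X]) ^ n).support.card ≤ 1 := fun n => by
    simpa only [map_one, one_mul] using (Polynomial.card_support_C_mul_X_pow_le_one (c := (1 : ℝ)) (n := n))
  linarith [ha (X ^ p₁ - X ^ p₂ - X ^ p₃) (X ^ p₄), hs (X ^ p₁ - X ^ p₂) (X ^ p₃), hs (X ^ p₁) (X ^ p₂), c p₁, c p₂, c p₃, c p₄]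

/-- **ANTI-RESONANT LAW at size `5` (kernel, all exponents)**: if the outer edge slopes are exactly opposite (`L₀ + L₃ = 0`), a unit-coefficient
static symmetric tridiagonal `5 × 5` design has at most THREE distinct positive determinant zeros. [this file] -/
theorem card_posRoots_unit_five_le_three_of_antiResonant
    (h : ((2 * f 0 : ℤ) - d 0 - d 1) + ((2 * f 3 : ℤ) - d 3 - d 4) = 0) :
    ((pathDet (fun _ => (1 : ℝ)) d (fun _ => (1 : ℝ)) f 5).roots.toFinset.filter (fun x => 0 < x)).card ≤ 3 := by
  set D := pathDet (fun _ => (1 : ℝ)) d (fun _ => (1 : ℝ)) f 5 with hD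
  by_cases hz : D = 0
  · rw [hz, Polynomial.roots_zero]; simp
  -- the common counting step: a factorisation `D = (X^a − 1)·W` with a four-monomial `W` vanishing at `1`
  have main : ∀ (W : ℝ[X]) (a : ℕ), D = (X ^ a - 1) * W → W.support.card ≤ 4 → W.eval 1 = 0 →
      (D.roots.toFinset.filter (fun x => 0 < x)).card ≤ 3 := by
    intro W a hfac hsupp hW1
    have hW : W ≠ 0 := fun hW => hz (by rw [hfac, hW, mul_zero])
    have hsub : D.roots.toFinset.filter (fun x => 0 < x) ⊆ W.roots.toFinset.filter (fun x => 0 < x) := by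
      intro x hx
      simp only [Finset.mem_filter, Multiset.mem_toFinset, mem_roots', IsRoot.def] at hx ⊢
      refine ⟨⟨hW, ?_⟩, hx.2⟩
      have hx' := hx.1.2
      rw [hfac, eval_mul, eval_sub, eval_pow, eval_X, eval_one] at hx'
      rcases mul_eq_zero.1 hx' with h1 | h1
      · have hx1 : x = 1 := by
          have hxa : x ^ a = 1 := by linarith
          rcases Nat.eq_zero_or_pos a with ha | ha
          · exfalso; apply hz; rw [hfac, ha, pow_zero, sub_self, zero_mul]
          · exact (pow_eq_one_iff_of_nonneg hx.2.le ha.ne').1 hxa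
        rw [hx1]; exact hW1
      · exact h1
    have hcount : W.roots.countP (fun x => 0 < x) ≤ 3 :=
      StaticTridiagonalRealPotential.countP_roots_pos_le_of_card_support_le (n := 3) hsupp
    have hcard : (W.roots.toFinset.filter (fun x => 0 < x)).card ≤ W.roots.countP (fun x => 0 < x) := by
      rw [← Multiset.toFinset_filter, Multiset.countP_eq_card_filter]
      exact Multiset.toFinset_card_le _
    exact (Finset.card_le_card hsub).trans (hcard.trans hcount)
  rcases le_or_gt 0 ((2 * f 0 : ℤ) - d 0 - d 1) with hL0 | hL0
  · -- `L₀ = a ≥ 0`, `L₃ = −a`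
    obtain ⟨a, ha⟩ : ∃ a : ℕ, ((2 * f 0 : ℤ) - d 0 - d 1) = a := ⟨_, (Int.toNat_of_nonneg hL0).symm⟩
    exact main _ a (unit_five_eq_mul_of_antiResonant d f a (by omega) (by omega)) (card_support_fourNomial_le _ _ _ _)
      (by simp)
  · -- `L₃ = a > 0`, `L₀ = −a`
    have hL3 : 0 ≤ (2 * f 3 : ℤ) - d 3 - d 4 := by omega
    obtain ⟨a, ha⟩ : ∃ a : ℕ, ((2 * f 3 : ℤ) - d 3 - d 4) = a := ⟨_, (Int.toNat_of_nonneg hL3).symm⟩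
    exact main _ a (unit_five_eq_mul_of_antiResonant' d f a (by omega) (by omega)) (card_support_fourNomial_le _ _ _ _)
      (by simp)

end StaticTridiagonalRealUnit
end Summit.ValiantsHypothesis.ValiantsHypothesis.Theorems.KPlusLogSqLaw
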